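import Mathlib
import HarnessLib

/-!
# Bernstein's dyadic interpolation: a weighted `ℓ¹` norm from TWO weighted `ℓ²` bounds (abstract finite form)

Topic `Probability/LatticeModels` (the abstract half of `TorusFourierBernstein.lean`; companion of `TorusFourierWienerBound` /
`TorusFourierFirstMoment` / `TorusFourierWeightedL1`).  Those files turn `ℓ²` information on the differences of a symbol into
`ℓ¹` (and first-moment) bounds of its lattice Fourier transform by ONE Cauchy–Schwarz against a weight `W` — which in `d`
dimensions with a moment of order `a` needs `W ≳ |x|^{2a+d+ε}`, i.e. MORE than `a + d/2` differences in a single package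
(three differences for a first moment in `2+1` dimensions).  Bernstein's proof of `Lip_α(𝕋) ⊂ A(𝕋)`, `α > 1/2`
(Katznelson, *An Introduction to Harmonic Analysis*, Ch. I §6.3, pp. 57–58) does better: Cauchy–Schwarz is applied on each
DYADIC SHELL `2^k ≤ |x| < 2^{k+1}` separately and the shells are summed, so that two orders `j₁ < a + d/2 < j₂` can be
INTERPOLATED, each shell using the better of the two tails.  This file records that argument for finite sums with explicit
constants (no limits).

On a finite index set with weights `μ ≥ 0` (a discrete measure), values `f ≥ 0` and a radius `r ≥ 0`, assume the volume
growth `Σ_{r < R} μ ≤ A·R^d` (`R ≥ 1`) and two tail bounds `Σ_{r ≥ 1} μ r^{2j_i} f² ≤ B_i²` with `2j₁ < 2a + d < 2j₂`; write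
`m₁ = 2a + d - 2j₁`, `m₂ = 2j₂ - 2a - d` and `θ = √2`.  Then

* `sum_filter_one_le_le_sum_shells` — the shells `{2^k ≤ r < 2^{k+1}}`, `k < K`, cover `{1 ≤ r}`;
* `sum_shell_le` — ONE shell: `Σ_{shell k} μ r^a f ≤ √A · B_j · θ^{(2a+d)(k+1)} / θ^{2jk}` (Cauchy–Schwarz on the shell);
* **`sum_mul_pow_mul_le_dyadic`** — for every crossover `k⋆`,
  `Σ_{r ≥ 1} μ r^a f ≤ √A θ^{2a+d} (B₁ ((θ^{m₁})^{k⋆} - 1)/(θ^{m₁} - 1) + B₂ ((θ^{m₂})⁻¹)^{k⋆}/(1 - (θ^{m₂})⁻¹))`;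
* **`sum_mul_pow_mul_le_sqrt`** — the symmetric case `m₁ = m₂ = m` optimised over `k⋆`:
  `Σ_{r ≥ 1} μ r^a f ≤ 2 θ^{2a+d} θ^m/(θ^m - 1) · √A · √(B₁ B₂)` — the GEOMETRIC MEAN of the two tail constants
  (instances `(a,d,j₁,j₂) = (1,3,2,3)`: first moments in `2+1` dimensions between two and three differences; `(1,2,1,3)`;
  `(0,3,1,2)` and `(0,2,0,2)`: plain `ℓ¹`);
* `sum_mul_pow_mul_filter_lt_one_le` — the near region `{r < 1}`: `Σ_{r < 1} μ r^a f ≤ √A · B₀` from `Σ μ f² ≤ B₀²`;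
  **`sum_mul_pow_mul_le_sqrt_add`** — the full sum: `Σ μ r^a f ≤ √A (B₀ + 2 θ^{2a+d} θ^m/(θ^m - 1) √(B₁ B₂))`;
* (private helpers: `2^n = θ^{2n}`, `1 < θ`, a finite family is below some `2^K`, geometric tails).

Everything is proved; no definitions, no named facts.

## Sources

Y. Katznelson, *An Introduction to Harmonic Analysis*, 3rd ed., CUP 2004, Ch. I §6.3 (Bernstein's theorem, dyadic proof,
(6.4)–(6.5)), pp. 57–58 [`Katznelson2004`].
-/

noncomputable section

open Finset

namespace Literature.Probability.LatticeModels

/-! ### §1 The abstract dyadic interpolation inequality -/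

section Abstract

variable {ι : Type*}

/-- **Dyadic shells cover `{1 ≤ r}`**: for nonnegative `g` and `r < 2^K` on `s`,
`Σ_{x ∈ s, 1 ≤ r x} g x ≤ Σ_{k < K} Σ_{x ∈ s, 2^k ≤ r x < 2^{k+1}} g x`. [cite: Katznelson2004, Ch. I §6.3] -/
theorem sum_filter_one_le_le_sum_shells (s : Finset ι) (r g : ι → ℝ) (hg : ∀ x ∈ s, 0 ≤ g x) (K : ℕ)
    (hK : ∀ x ∈ s, r x < (2 : ℝ) ^ K) :
    ∑ x ∈ s.filter (fun x => 1 ≤ r x), g x ≤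
      ∑ k ∈ range K, ∑ x ∈ s.filter (fun x => (2 : ℝ) ^ k ≤ r x ∧ r x < (2 : ℝ) ^ (k + 1)), g x := by
  classical
  rw [sum_filter]
  have hR : ∑ k ∈ range K, ∑ x ∈ s.filter (fun x => (2 : ℝ) ^ k ≤ r x ∧ r x < (2 : ℝ) ^ (k + 1)), g x =
      ∑ x ∈ s, ∑ k ∈ range K, if (2 : ℝ) ^ k ≤ r x ∧ r x < (2 : ℝ) ^ (k + 1) then g x else 0 := by
    rw [sum_comm]
    exact sum_congr rfl fun k _ => sum_filter _ _
  rw [hR]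
  refine sum_le_sum fun x hx => ?_
  have hnn : ∀ k ∈ range K, 0 ≤ (if (2 : ℝ) ^ k ≤ r x ∧ r x < (2 : ℝ) ^ (k + 1) then g x else 0) :=
    fun k _ => by split_ifs <;> [exact hg x hx; exact le_rfl]
  split_ifs with h1
  · -- `x` lies in the shell `k₀ = min {k : r x < 2^{k+1}}`, and `k₀ < K`
    have hK1 : 1 ≤ K := by
      rcases Nat.eq_zero_or_pos K with h0 | h0
      · exact absurd (hK x hx) (by rw [h0, pow_zero]; exact not_lt.2 h1)
      · exact h0
    have hex : ∃ k : ℕ, r x < (2 : ℝ) ^ (k + 1) := ⟨K - 1, by rw [Nat.sub_add_cancel hK1]; exact hK x hx⟩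
    set k₀ := Nat.find hex with hk₀
    have hup : r x < (2 : ℝ) ^ (k₀ + 1) := Nat.find_spec hex
    have hlow : (2 : ℝ) ^ k₀ ≤ r x := by
      rcases Nat.eq_zero_or_pos k₀ with h0 | h0
      · rw [h0, pow_zero]; exact h1
      · have hmin := Nat.find_min hex (m := k₀ - 1) (by omega)
        rw [Nat.sub_add_cancel h0] at hmin
        exact not_lt.1 hmin
    have hk₀K : k₀ ∈ range K := by
      rw [mem_range]
      have : k₀ ≤ K - 1 := Nat.find_le (by rw [Nat.sub_add_cancel hK1]; exact hK x hx)
      omega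
    refine (le_of_eq ?_).trans (single_le_sum hnn hk₀K)
    rw [if_pos ⟨hlow, hup⟩]
  · exact sum_nonneg hnn

/-- `2 = θ²` bookkeeping: `(2:ℝ)^n = (√2)^(2n)`. [folklore] -/
private theorem two_pow_eq_sqrt_two_pow (n : ℕ) : (2 : ℝ) ^ n = Real.sqrt 2 ^ (2 * n) := by
  rw [pow_mul, Real.sq_sqrt (by norm_num : (0 : ℝ) ≤ 2)]

/-- **One dyadic shell** (Cauchy–Schwarz on the shell): under the volume growth `Σ_{r < R} μ ≤ A R^d` and the tail bound
`Σ_{1 ≤ r} μ r^{2j} f² ≤ B²`, `Σ_{2^k ≤ r < 2^{k+1}} μ r^a f ≤ √A · B · θ^{(2a+d)(k+1)} / θ^{2jk}`, `θ = √2`. [cite: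
Katznelson2004, Ch. I §6.3, (6.4)–(6.5)] -/
theorem sum_shell_le (s : Finset ι) (μ f r : ι → ℝ) (hμ : ∀ x ∈ s, 0 ≤ μ x) (hf : ∀ x ∈ s, 0 ≤ f x)
    (hr : ∀ x ∈ s, 0 ≤ r x) {a d j : ℕ} {A B : ℝ} (hA : 0 ≤ A) (hB : 0 ≤ B)
    (hcount : ∀ R : ℝ, 1 ≤ R → ∑ x ∈ s.filter (fun x => r x < R), μ x ≤ A * R ^ d)
    (htail : ∑ x ∈ s.filter (fun x => 1 ≤ r x), μ x * r x ^ (2 * j) * f x ^ 2 ≤ B ^ 2) (k : ℕ) :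
    ∑ x ∈ s.filter (fun x => (2 : ℝ) ^ k ≤ r x ∧ r x < (2 : ℝ) ^ (k + 1)), μ x * r x ^ a * f x ≤
      Real.sqrt A * B * Real.sqrt 2 ^ ((2 * a + d) * (k + 1)) / Real.sqrt 2 ^ (2 * j * k) := by
  set S := s.filter (fun x => (2 : ℝ) ^ k ≤ r x ∧ r x < (2 : ℝ) ^ (k + 1)) with hS
  have hSs : S ⊆ s := filter_subset _ _
  have hmemS : ∀ x ∈ S, x ∈ s ∧ (2 : ℝ) ^ k ≤ r x ∧ r x < (2 : ℝ) ^ (k + 1) := fun x hx => by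
    simpa [hS, mem_filter] using hx
  have h2k : (1 : ℝ) ≤ (2 : ℝ) ^ k := one_le_pow₀ (by norm_num)
  have h2k0 : (0 : ℝ) < (2 : ℝ) ^ k := by positivity
  -- step 1: `r^a ≤ (2^{k+1})^a` on the shell
  have h1 : ∑ x ∈ S, μ x * r x ^ a * f x ≤ ((2 : ℝ) ^ (k + 1)) ^ a * ∑ x ∈ S, μ x * f x := by
    rw [mul_sum]
    refine sum_le_sum fun x hx => ?_
    obtain ⟨hxs, -, hup⟩ := hmemS x hx
    have : r x ^ a ≤ ((2 : ℝ) ^ (k + 1)) ^ a := pow_le_pow_left₀ (hr x hxs) hup.le a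
    calc μ x * r x ^ a * f x = r x ^ a * (μ x * f x) := by ring
      _ ≤ ((2 : ℝ) ^ (k + 1)) ^ a * (μ x * f x) :=
        mul_le_mul_of_nonneg_right this (mul_nonneg (hμ x hxs) (hf x hxs))
  -- step 2: Cauchy–Schwarz `Σ μ f ≤ √(Σ μ) √(Σ μ f²)`
  have h2 : ∑ x ∈ S, μ x * f x ≤ Real.sqrt (∑ x ∈ S, μ x) * Real.sqrt (∑ x ∈ S, μ x * f x ^ 2) := by
    have hcs := Real.sum_mul_le_sqrt_mul_sqrt S (fun x => Real.sqrt (μ x)) (fun x => Real.sqrt (μ x) * f x)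
    have e1 : ∀ x ∈ S, Real.sqrt (μ x) * (Real.sqrt (μ x) * f x) = μ x * f x := fun x hx => by
      rw [← mul_assoc, Real.mul_self_sqrt (hμ x (hSs hx))]
    have e2 : ∀ x ∈ S, Real.sqrt (μ x) ^ 2 = μ x := fun x hx => Real.sq_sqrt (hμ x (hSs hx))
    have e3 : ∀ x ∈ S, (Real.sqrt (μ x) * f x) ^ 2 = μ x * f x ^ 2 := fun x hx => by
      rw [mul_pow, Real.sq_sqrt (hμ x (hSs hx))]
    rwa [sum_congr rfl e1, sum_congr rfl e2, sum_congr rfl e3] at hcs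
  -- step 3: the volume of the shell
  have h3 : ∑ x ∈ S, μ x ≤ A * ((2 : ℝ) ^ (k + 1)) ^ d := by
    refine le_trans ?_ (hcount _ (one_le_pow₀ (by norm_num)))
    refine sum_le_sum_of_subset_of_nonneg (fun x hx => ?_) fun x hx _ => hμ x (mem_filter.1 hx).1
    obtain ⟨hxs, -, hup⟩ := hmemS x hx
    exact mem_filter.2 ⟨hxs, hup⟩
  -- step 4: the tail on the shell, `Σ_S μ f² ≤ B² / (2^k)^{2j}`
  have h4 : ∑ x ∈ S, μ x * f x ^ 2 ≤ B ^ 2 / ((2 : ℝ) ^ k) ^ (2 * j) := by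
    rw [le_div_iff₀ (by positivity), sum_mul]
    calc ∑ x ∈ S, μ x * f x ^ 2 * ((2 : ℝ) ^ k) ^ (2 * j) ≤ ∑ x ∈ S, μ x * r x ^ (2 * j) * f x ^ 2 := by
          refine sum_le_sum fun x hx => ?_
          obtain ⟨hxs, hlow, -⟩ := hmemS x hx
          have : ((2 : ℝ) ^ k) ^ (2 * j) ≤ r x ^ (2 * j) := pow_le_pow_left₀ h2k0.le hlow _
          calc μ x * f x ^ 2 * ((2 : ℝ) ^ k) ^ (2 * j) = (μ x * f x ^ 2) * ((2 : ℝ) ^ k) ^ (2 * j) := by ring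
            _ ≤ (μ x * f x ^ 2) * r x ^ (2 * j) :=
              mul_le_mul_of_nonneg_left this (mul_nonneg (hμ x hxs) (sq_nonneg _))
            _ = μ x * r x ^ (2 * j) * f x ^ 2 := by ring
      _ ≤ ∑ x ∈ s.filter (fun x => 1 ≤ r x), μ x * r x ^ (2 * j) * f x ^ 2 := by
          refine sum_le_sum_of_subset_of_nonneg (fun x hx => ?_) (fun x hx _ => ?_)
          · obtain ⟨hxs, hlow, -⟩ := hmemS x hx
            exact mem_filter.2 ⟨hxs, h2k.trans hlow⟩
          · have hxs := (mem_filter.1 hx).1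
            exact mul_nonneg (mul_nonneg (hμ x hxs) (pow_nonneg (hr x hxs) _)) (sq_nonneg _)
      _ ≤ B ^ 2 := htail
  -- assemble
  have hsum0 : 0 ≤ ∑ x ∈ S, μ x := sum_nonneg fun x hx => hμ x (hSs hx)
  have hS1 : Real.sqrt (∑ x ∈ S, μ x) ≤ Real.sqrt A * Real.sqrt 2 ^ (d * (k + 1)) := by
    calc Real.sqrt (∑ x ∈ S, μ x) ≤ Real.sqrt (A * ((2 : ℝ) ^ (k + 1)) ^ d) := Real.sqrt_le_sqrt h3
      _ = Real.sqrt A * Real.sqrt 2 ^ (d * (k + 1)) := by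
        rw [Real.sqrt_mul hA, ← pow_mul, two_pow_eq_sqrt_two_pow, show 2 * ((k + 1) * d) = d * (k + 1) * 2 by ring,
          pow_mul, Real.sqrt_sq (by positivity)]
  have hS2 : Real.sqrt (∑ x ∈ S, μ x * f x ^ 2) ≤ B / Real.sqrt 2 ^ (2 * j * k) := by
    calc Real.sqrt (∑ x ∈ S, μ x * f x ^ 2) ≤ Real.sqrt (B ^ 2 / ((2 : ℝ) ^ k) ^ (2 * j)) := Real.sqrt_le_sqrt h4
      _ = B / Real.sqrt 2 ^ (2 * j * k) := by
        rw [Real.sqrt_div' _ (by positivity), Real.sqrt_sq hB, ← pow_mul, two_pow_eq_sqrt_two_pow,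
          show 2 * (k * (2 * j)) = 2 * j * k * 2 by ring, pow_mul, Real.sqrt_sq (by positivity)]
  have h2a : ((2 : ℝ) ^ (k + 1)) ^ a = Real.sqrt 2 ^ (2 * a * (k + 1)) := by
    rw [← pow_mul, two_pow_eq_sqrt_two_pow, show 2 * ((k + 1) * a) = 2 * a * (k + 1) by ring]
  calc ∑ x ∈ S, μ x * r x ^ a * f x
      ≤ ((2 : ℝ) ^ (k + 1)) ^ a * (Real.sqrt (∑ x ∈ S, μ x) * Real.sqrt (∑ x ∈ S, μ x * f x ^ 2)) :=
        h1.trans (mul_le_mul_of_nonneg_left h2 (by positivity))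
    _ ≤ ((2 : ℝ) ^ (k + 1)) ^ a * ((Real.sqrt A * Real.sqrt 2 ^ (d * (k + 1))) * (B / Real.sqrt 2 ^ (2 * j * k))) := by
        gcongr
    _ = Real.sqrt A * B * Real.sqrt 2 ^ ((2 * a + d) * (k + 1)) / Real.sqrt 2 ^ (2 * j * k) := by
        rw [h2a, show (2 * a + d) * (k + 1) = 2 * a * (k + 1) + d * (k + 1) by ring, pow_add]
        ring

/-- `1 < √2`. [folklore] -/
private theorem one_lt_sqrt_two' : (1 : ℝ) < Real.sqrt 2 := by
  rw [show (1 : ℝ) = Real.sqrt 1 by rw [Real.sqrt_one]]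
  exact Real.sqrt_lt_sqrt (by norm_num) (by norm_num)

/-- A finite family of reals is bounded by a power of two. [folklore] -/
private theorem exists_forall_lt_two_pow (s : Finset ι) (r : ι → ℝ) : ∃ K : ℕ, ∀ x ∈ s, r x < (2 : ℝ) ^ K := by
  obtain ⟨K, hK⟩ := pow_unbounded_of_one_lt (∑ x ∈ s, |r x|) (one_lt_two (α := ℝ))
  refine ⟨K, fun x hx => lt_of_le_of_lt ?_ hK⟩
  exact (le_abs_self _).trans (single_le_sum (f := fun x => |r x|) (fun y _ => abs_nonneg _) hx)

/-- Tail of a geometric series over a finite set of exponents `≥ k⋆`: `Σ_{k ∈ F} ρ^k ≤ ρ^{k⋆}/(1 - ρ)` for `0 ≤ ρ < 1`. [folklore] -/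
private theorem sum_pow_le_pow_div_of_le (F : Finset ℕ) {ρ : ℝ} (hρ0 : 0 ≤ ρ) (hρ1 : ρ < 1) (kstar : ℕ)
    (hF : ∀ k ∈ F, kstar ≤ k) : ∑ k ∈ F, ρ ^ k ≤ ρ ^ kstar / (1 - ρ) := by
  classical
  have hshift : ∀ k ∈ F, ρ ^ k = ρ ^ kstar * ρ ^ (k - kstar) := fun k hk => by
    rw [← pow_add, Nat.add_sub_cancel' (hF k hk)]
  rw [sum_congr rfl hshift, ← mul_sum, div_eq_mul_inv]
  refine mul_le_mul_of_nonneg_left ?_ (pow_nonneg hρ0 _)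
  have hinj : Set.InjOn (fun k => k - kstar) F := by
    intro a ha b hb h
    have := hF a ha; have := hF b hb
    simp only at h; omega
  rw [← Finset.sum_image hinj, ← tsum_geometric_of_lt_one hρ0 hρ1]
  exact (summable_geometric_of_lt_one hρ0 hρ1).sum_le_tsum _ fun i _ => pow_nonneg hρ0 _

/-- **Bernstein's dyadic interpolation, crossover form.**  On a finite set with weights `μ ≥ 0`, values `f ≥ 0` and radius
`r ≥ 0`, assume the volume growth `Σ_{r < R} μ ≤ A·R^d` (`R ≥ 1`) and the two tail bounds `Σ_{1 ≤ r} μ r^{2j_i} f² ≤ B_i²`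
with `2j₁ + m₁ = 2a + d = 2j₂ - m₂`, `m₁, m₂ ≥ 1`.  Then for every crossover `k⋆`, with `θ = √2`,
`Σ_{1 ≤ r} μ r^a f ≤ √A θ^{2a+d} (B₁ ((θ^{m₁})^{k⋆} - 1)/(θ^{m₁} - 1) + B₂ ((θ^{m₂})⁻¹)^{k⋆}/(1 - (θ^{m₂})⁻¹))`
(shells below `2^{k⋆}` are paid by the `j₁`-tail, shells above by the `j₂`-tail). [cite: Katznelson2004, Ch. I §6.3, pp. 57–58] -/
theorem sum_mul_pow_mul_le_dyadic (s : Finset ι) (μ f r : ι → ℝ) (hμ : ∀ x ∈ s, 0 ≤ μ x) (hf : ∀ x ∈ s, 0 ≤ f x)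
    (hr : ∀ x ∈ s, 0 ≤ r x) {a d j₁ j₂ m₁ m₂ : ℕ} (hm₁ : 2 * j₁ + m₁ = 2 * a + d) (hm₂ : 2 * a + d + m₂ = 2 * j₂)
    (hm₁0 : 0 < m₁) (hm₂0 : 0 < m₂) {A B₁ B₂ : ℝ} (hA : 0 ≤ A) (hB₁ : 0 ≤ B₁) (hB₂ : 0 ≤ B₂)
    (hcount : ∀ R : ℝ, 1 ≤ R → ∑ x ∈ s.filter (fun x => r x < R), μ x ≤ A * R ^ d)
    (htail₁ : ∑ x ∈ s.filter (fun x => 1 ≤ r x), μ x * r x ^ (2 * j₁) * f x ^ 2 ≤ B₁ ^ 2)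
    (htail₂ : ∑ x ∈ s.filter (fun x => 1 ≤ r x), μ x * r x ^ (2 * j₂) * f x ^ 2 ≤ B₂ ^ 2) (kstar : ℕ) :
    ∑ x ∈ s.filter (fun x => 1 ≤ r x), μ x * r x ^ a * f x ≤
      Real.sqrt A * Real.sqrt 2 ^ (2 * a + d) *
        (B₁ * ((Real.sqrt 2 ^ m₁) ^ kstar - 1) / (Real.sqrt 2 ^ m₁ - 1) +
          B₂ * ((Real.sqrt 2 ^ m₂)⁻¹) ^ kstar / (1 - (Real.sqrt 2 ^ m₂)⁻¹)) := by
  classical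
  set θ := Real.sqrt 2 with hθ
  have hθ1 : 1 < θ := one_lt_sqrt_two'
  have hθ0 : 0 < θ := one_pos.trans hθ1
  set q := θ ^ m₁ with hq
  have hq1 : 1 < q := one_lt_pow₀ hθ1 hm₁0.ne'
  set ρ := (θ ^ m₂)⁻¹ with hρ
  have hρ0 : 0 ≤ ρ := by positivity
  have hρ1 : ρ < 1 := inv_lt_one_of_one_lt₀ (one_lt_pow₀ hθ1 hm₂0.ne')
  obtain ⟨K, hK⟩ := exists_forall_lt_two_pow s r
  have hg : ∀ x ∈ s, 0 ≤ μ x * r x ^ a * f x := fun x hx =>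
    mul_nonneg (mul_nonneg (hμ x hx) (pow_nonneg (hr x hx) _)) (hf x hx)
  refine (sum_filter_one_le_le_sum_shells s r _ hg K hK).trans ?_
  -- the two shell bounds
  set T : ℕ → ℝ := fun k =>
    ∑ x ∈ s.filter (fun x => (2 : ℝ) ^ k ≤ r x ∧ r x < (2 : ℝ) ^ (k + 1)), μ x * r x ^ a * f x with hT
  have hT0 : ∀ k, 0 ≤ T k := fun k => sum_nonneg fun x hx => hg x (mem_filter.1 hx).1
  have hlow : ∀ k, T k ≤ Real.sqrt A * B₁ * θ ^ (2 * a + d) * q ^ k := by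
    intro k
    have h := sum_shell_le s μ f r hμ hf hr (a := a) (d := d) hA hB₁ hcount htail₁ k
    have hexp : θ ^ ((2 * a + d) * (k + 1)) / θ ^ (2 * j₁ * k) = θ ^ (2 * a + d) * q ^ k := by
      rw [div_eq_iff (by positivity), hq, ← pow_mul,
        show (2 * a + d) * (k + 1) = (2 * a + d) + m₁ * k + 2 * j₁ * k by rw [← hm₁]; ring, pow_add, pow_add]
    calc T k ≤ Real.sqrt A * B₁ * θ ^ ((2 * a + d) * (k + 1)) / θ ^ (2 * j₁ * k) := h
      _ = Real.sqrt A * B₁ * (θ ^ ((2 * a + d) * (k + 1)) / θ ^ (2 * j₁ * k)) := by ring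
      _ = Real.sqrt A * B₁ * θ ^ (2 * a + d) * q ^ k := by rw [hexp]; ring
  have hhigh : ∀ k, T k ≤ Real.sqrt A * B₂ * θ ^ (2 * a + d) * ρ ^ k := by
    intro k
    have h := sum_shell_le s μ f r hμ hf hr (a := a) (d := d) hA hB₂ hcount htail₂ k
    have hexp : θ ^ ((2 * a + d) * (k + 1)) / θ ^ (2 * j₂ * k) = θ ^ (2 * a + d) * ρ ^ k := by
      rw [div_eq_iff (by positivity)]
      have h1 : θ ^ (2 * j₂ * k) = θ ^ ((2 * a + d) * k) * (θ ^ m₂) ^ k := by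
        rw [← pow_mul, ← pow_add]
        congr 1
        rw [← hm₂]
        ring
      have h2 : ((θ ^ m₂) ^ k)⁻¹ * (θ ^ m₂) ^ k = 1 := inv_mul_cancel₀ (by positivity)
      rw [h1, hρ, inv_pow]
      calc θ ^ ((2 * a + d) * (k + 1)) = θ ^ (2 * a + d) * θ ^ ((2 * a + d) * k) * 1 := by
            rw [mul_one, ← pow_add]; congr 1; ring
        _ = θ ^ (2 * a + d) * ((θ ^ m₂) ^ k)⁻¹ * (θ ^ ((2 * a + d) * k) * (θ ^ m₂) ^ k) := by
            rw [← h2]; ring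
    calc T k ≤ Real.sqrt A * B₂ * θ ^ ((2 * a + d) * (k + 1)) / θ ^ (2 * j₂ * k) := h
      _ = Real.sqrt A * B₂ * (θ ^ ((2 * a + d) * (k + 1)) / θ ^ (2 * j₂ * k)) := by ring
      _ = Real.sqrt A * B₂ * θ ^ (2 * a + d) * ρ ^ k := by rw [hexp]; ring
  -- split the shells at the crossover
  rw [← sum_filter_add_sum_filter_not (range K) (fun k => k < kstar)]
  have hpart1 : ∑ k ∈ (range K).filter (fun k => k < kstar), T k ≤
      Real.sqrt A * B₁ * θ ^ (2 * a + d) * ((q ^ kstar - 1) / (q - 1)) := by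
    calc ∑ k ∈ (range K).filter (fun k => k < kstar), T k
        ≤ ∑ k ∈ (range K).filter (fun k => k < kstar), Real.sqrt A * B₁ * θ ^ (2 * a + d) * q ^ k :=
          sum_le_sum fun k _ => hlow k
      _ ≤ ∑ k ∈ range kstar, Real.sqrt A * B₁ * θ ^ (2 * a + d) * q ^ k := by
          refine sum_le_sum_of_subset_of_nonneg (fun k hk => ?_) fun k _ _ => by positivity
          rw [mem_filter] at hk
          exact mem_range.2 hk.2
      _ = Real.sqrt A * B₁ * θ ^ (2 * a + d) * ((q ^ kstar - 1) / (q - 1)) := by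
          rw [← mul_sum, geom_sum_eq hq1.ne' kstar]
  have hpart2 : ∑ k ∈ (range K).filter (fun k => ¬ k < kstar), T k ≤
      Real.sqrt A * B₂ * θ ^ (2 * a + d) * (ρ ^ kstar / (1 - ρ)) := by
    calc ∑ k ∈ (range K).filter (fun k => ¬ k < kstar), T k
        ≤ ∑ k ∈ (range K).filter (fun k => ¬ k < kstar), Real.sqrt A * B₂ * θ ^ (2 * a + d) * ρ ^ k :=
          sum_le_sum fun k _ => hhigh k
      _ = Real.sqrt A * B₂ * θ ^ (2 * a + d) * ∑ k ∈ (range K).filter (fun k => ¬ k < kstar), ρ ^ k := by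
          rw [mul_sum]
      _ ≤ Real.sqrt A * B₂ * θ ^ (2 * a + d) * (ρ ^ kstar / (1 - ρ)) := by
          refine mul_le_mul_of_nonneg_left (sum_pow_le_pow_div_of_le _ hρ0 hρ1 kstar fun k hk => ?_) (by positivity)
          rw [mem_filter] at hk
          exact not_lt.1 hk.2
  calc ∑ k ∈ (range K).filter (fun k => k < kstar), T k + ∑ k ∈ (range K).filter (fun k => ¬ k < kstar), T k
      ≤ Real.sqrt A * B₁ * θ ^ (2 * a + d) * ((q ^ kstar - 1) / (q - 1)) +
          Real.sqrt A * B₂ * θ ^ (2 * a + d) * (ρ ^ kstar / (1 - ρ)) := add_le_add hpart1 hpart2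
    _ = Real.sqrt A * θ ^ (2 * a + d) * (B₁ * (q ^ kstar - 1) / (q - 1) + B₂ * ρ ^ kstar / (1 - ρ)) := by ring

/-- **Bernstein's dyadic interpolation, symmetric optimised form.**  In the situation of `sum_mul_pow_mul_le_dyadic` with
`m₁ = m₂ = m` (the two orders `j₁ < a + d/2 < j₂` symmetric about `a + d/2`), choosing the crossover at `θ^{2 m k⋆} ≈ B₂/B₁`:
`Σ_{1 ≤ r} μ r^a f ≤ 2 θ^{2a+d} · θ^m/(θ^m - 1) · √A · √(B₁ B₂)`, `θ = √2` — the weighted `ℓ¹` norm is the GEOMETRIC MEAN of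
the two tail constants.  Instances: `(a,d,j₁,j₂) = (1,3,2,3)` (first moment in `2+1` dimensions from two and three differences),
`(1,2,1,3)`, `(0,3,1,2)`, `(0,2,0,2)`. [cite: Katznelson2004, Ch. I §6.3, pp. 57–58] -/
theorem sum_mul_pow_mul_le_sqrt (s : Finset ι) (μ f r : ι → ℝ) (hμ : ∀ x ∈ s, 0 ≤ μ x) (hf : ∀ x ∈ s, 0 ≤ f x)
    (hr : ∀ x ∈ s, 0 ≤ r x) {a d j₁ j₂ m : ℕ} (hm₁ : 2 * j₁ + m = 2 * a + d) (hm₂ : 2 * a + d + m = 2 * j₂)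
    (hm0 : 0 < m) {A B₁ B₂ : ℝ} (hA : 0 ≤ A) (hB₁ : 0 ≤ B₁) (hB₂ : 0 ≤ B₂)
    (hcount : ∀ R : ℝ, 1 ≤ R → ∑ x ∈ s.filter (fun x => r x < R), μ x ≤ A * R ^ d)
    (htail₁ : ∑ x ∈ s.filter (fun x => 1 ≤ r x), μ x * r x ^ (2 * j₁) * f x ^ 2 ≤ B₁ ^ 2)
    (htail₂ : ∑ x ∈ s.filter (fun x => 1 ≤ r x), μ x * r x ^ (2 * j₂) * f x ^ 2 ≤ B₂ ^ 2) :
    ∑ x ∈ s.filter (fun x => 1 ≤ r x), μ x * r x ^ a * f x ≤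
      2 * Real.sqrt 2 ^ (2 * a + d) * (Real.sqrt 2 ^ m / (Real.sqrt 2 ^ m - 1)) * Real.sqrt A * Real.sqrt (B₁ * B₂) := by
  classical
  set θ := Real.sqrt 2 with hθ
  have hθ1 : 1 < θ := one_lt_sqrt_two'
  have hθ0 : 0 < θ := one_pos.trans hθ1
  set q := θ ^ m with hq
  have hq1 : 1 < q := one_lt_pow₀ hθ1 hm0.ne'
  have hq0 : 0 < q := one_pos.trans hq1
  have hqm1 : 0 < q - 1 := sub_pos.2 hq1
  have hs'nn : ∀ x ∈ s.filter (fun x => 1 ≤ r x), 0 ≤ μ x * r x ^ (2 * j₁) * f x ^ 2 := fun x hx =>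
    mul_nonneg (mul_nonneg (hμ x (mem_filter.1 hx).1) (pow_nonneg (hr x (mem_filter.1 hx).1) _)) (sq_nonneg _)
  have hRHS0 : 0 ≤ 2 * θ ^ (2 * a + d) * (q / (q - 1)) * Real.sqrt A * Real.sqrt (B₁ * B₂) := by positivity
  rcases hB₁.eq_or_lt with hB₁0 | hB₁pos
  · -- `B₁ = 0`: every term vanishes
    refine le_trans (le_of_eq (sum_eq_zero fun x hx => ?_)) hRHS0
    have hzero := (sum_eq_zero_iff_of_nonneg hs'nn).1
      (le_antisymm (by rw [← hB₁0, zero_pow two_ne_zero] at htail₁; exact htail₁) (sum_nonneg hs'nn)) x hx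
    have hx1 : 1 ≤ r x := (mem_filter.1 hx).2
    have hrpow : r x ^ (2 * j₁) ≠ 0 := pow_ne_zero _ (by linarith)
    rcases mul_eq_zero.1 hzero with h | h
    · rcases mul_eq_zero.1 h with h' | h'
      · rw [h', zero_mul, zero_mul]
      · exact absurd h' hrpow
    · rw [pow_eq_zero_iff two_ne_zero] at h
      rw [h, mul_zero]
  · -- `B₁ > 0`: choose the crossover
    have hex : ∃ n : ℕ, B₂ < B₁ * (q ^ n) ^ 2 := by
      obtain ⟨n, hn⟩ := pow_unbounded_of_one_lt (B₂ / B₁) (one_lt_pow₀ hq1 two_ne_zero)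
      refine ⟨n, ?_⟩
      rw [div_lt_iff₀ hB₁pos] at hn
      calc B₂ < (q ^ 2) ^ n * B₁ := hn
        _ = B₁ * (q ^ n) ^ 2 := by ring
    set kstar := Nat.find hex with hkstar
    have hk1 : B₂ < B₁ * (q ^ kstar) ^ 2 := Nat.find_spec hex
    have hmain := sum_mul_pow_mul_le_dyadic s μ f r hμ hf hr hm₁ hm₂ hm0 hm0 hA hB₁ hB₂ hcount htail₁ htail₂ kstar
    have hsq0 : 0 ≤ Real.sqrt (B₁ * B₂) := Real.sqrt_nonneg _
    -- the high term
    have hterm2 : B₂ * (q⁻¹) ^ kstar / (1 - q⁻¹) ≤ q / (q - 1) * Real.sqrt (B₁ * B₂) := by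
      have hle : B₂ / q ^ kstar ≤ Real.sqrt (B₁ * B₂) := by
        refine Real.le_sqrt_of_sq_le ?_
        rw [div_pow, div_le_iff₀ (by positivity)]
        calc B₂ ^ 2 = B₂ * B₂ := sq B₂
          _ ≤ B₂ * (B₁ * (q ^ kstar) ^ 2) := mul_le_mul_of_nonneg_left hk1.le hB₂
          _ = B₁ * B₂ * (q ^ kstar) ^ 2 := by ring
      have hid : B₂ * (q⁻¹) ^ kstar / (1 - q⁻¹) = q / (q - 1) * (B₂ / q ^ kstar) := by
        rw [inv_pow]
        field_simp
      rw [hid]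
      exact mul_le_mul_of_nonneg_left hle (by positivity)
    -- the low term
    have hterm1 : B₁ * (q ^ kstar - 1) / (q - 1) ≤ q / (q - 1) * Real.sqrt (B₁ * B₂) := by
      rcases Nat.eq_zero_or_pos kstar with hk0 | hkpos
      · rw [hk0, pow_zero, sub_self, mul_zero, zero_div]
        positivity
      · have hk2 : B₁ * (q ^ (kstar - 1)) ^ 2 ≤ B₂ := not_lt.1 (Nat.find_min hex (Nat.sub_lt hkpos one_pos))
        have hle : B₁ * q ^ (kstar - 1) ≤ Real.sqrt (B₁ * B₂) := by
          refine Real.le_sqrt_of_sq_le ?_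
          calc (B₁ * q ^ (kstar - 1)) ^ 2 = B₁ * (B₁ * (q ^ (kstar - 1)) ^ 2) := by ring
            _ ≤ B₁ * B₂ := mul_le_mul_of_nonneg_left hk2 hB₁
        have hqk : q ^ kstar = q * q ^ (kstar - 1) := by
          rw [← pow_succ', Nat.sub_add_cancel hkpos]
        rw [div_le_iff₀ hqm1, show q / (q - 1) * Real.sqrt (B₁ * B₂) * (q - 1) = q * Real.sqrt (B₁ * B₂) by
          field_simp]
        calc B₁ * (q ^ kstar - 1) ≤ B₁ * q ^ kstar := by nlinarith
          _ = q * (B₁ * q ^ (kstar - 1)) := by rw [hqk]; ring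
          _ ≤ q * Real.sqrt (B₁ * B₂) := mul_le_mul_of_nonneg_left hle hq0.le
    calc ∑ x ∈ s.filter (fun x => 1 ≤ r x), μ x * r x ^ a * f x
        ≤ Real.sqrt A * θ ^ (2 * a + d) * (B₁ * (q ^ kstar - 1) / (q - 1) + B₂ * (q⁻¹) ^ kstar / (1 - q⁻¹)) := hmain
      _ ≤ Real.sqrt A * θ ^ (2 * a + d) * (q / (q - 1) * Real.sqrt (B₁ * B₂) + q / (q - 1) * Real.sqrt (B₁ * B₂)) := by
          exact mul_le_mul_of_nonneg_left (add_le_add hterm1 hterm2) (by positivity)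
      _ = 2 * θ ^ (2 * a + d) * (q / (q - 1)) * Real.sqrt A * Real.sqrt (B₁ * B₂) := by ring

/-- **The near region** `{r < 1}` (not covered by the dyadic shells): for `a : ℕ`, `r^a ≤ 1` there, so one Cauchy–Schwarz
gives `Σ_{r < 1} μ r^a f ≤ √A · B₀` from the volume growth at `R = 1` and the plain `ℓ²` bound `Σ μ f² ≤ B₀²` (on a lattice
with integer radius this is the single point `x = 0`; on a space-time lattice with time mesh `κ < 1` it is the set of times
shorter than one spatial lattice spacing). [cite: Katznelson2004, Ch. I §6.3, proof of Theorem (Bernstein) (the term `n = 0`)] -/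
theorem sum_mul_pow_mul_filter_lt_one_le (s : Finset ι) (μ f r : ι → ℝ) (hμ : ∀ x ∈ s, 0 ≤ μ x) (hf : ∀ x ∈ s, 0 ≤ f x)
    (hr : ∀ x ∈ s, 0 ≤ r x) (a : ℕ) {d : ℕ} {A B₀ : ℝ} (hB₀ : 0 ≤ B₀)
    (hcount : ∀ R : ℝ, 1 ≤ R → ∑ x ∈ s.filter (fun x => r x < R), μ x ≤ A * R ^ d)
    (hℓ2 : ∑ x ∈ s, μ x * f x ^ 2 ≤ B₀ ^ 2) :
    ∑ x ∈ s.filter (fun x => r x < 1), μ x * r x ^ a * f x ≤ Real.sqrt A * B₀ := by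
  set S := s.filter (fun x => r x < 1) with hS
  have hSs : S ⊆ s := filter_subset _ _
  have h1 : ∑ x ∈ S, μ x * r x ^ a * f x ≤ ∑ x ∈ S, μ x * f x := by
    refine sum_le_sum fun x hx => ?_
    have hxs := hSs hx
    have hra : r x ^ a ≤ 1 := pow_le_one₀ (hr x hxs) (mem_filter.1 hx).2.le
    calc μ x * r x ^ a * f x = r x ^ a * (μ x * f x) := by ring
      _ ≤ 1 * (μ x * f x) := mul_le_mul_of_nonneg_right hra (mul_nonneg (hμ x hxs) (hf x hxs))
      _ = μ x * f x := one_mul _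
  have h2 : ∑ x ∈ S, μ x * f x ≤ Real.sqrt (∑ x ∈ S, μ x) * Real.sqrt (∑ x ∈ S, μ x * f x ^ 2) := by
    have hcs := Real.sum_mul_le_sqrt_mul_sqrt S (fun x => Real.sqrt (μ x)) (fun x => Real.sqrt (μ x) * f x)
    have e1 : ∀ x ∈ S, Real.sqrt (μ x) * (Real.sqrt (μ x) * f x) = μ x * f x := fun x hx => by
      rw [← mul_assoc, Real.mul_self_sqrt (hμ x (hSs hx))]
    have e2 : ∀ x ∈ S, Real.sqrt (μ x) ^ 2 = μ x := fun x hx => Real.sq_sqrt (hμ x (hSs hx))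
    have e3 : ∀ x ∈ S, (Real.sqrt (μ x) * f x) ^ 2 = μ x * f x ^ 2 := fun x hx => by
      rw [mul_pow, Real.sq_sqrt (hμ x (hSs hx))]
    rwa [sum_congr rfl e1, sum_congr rfl e2, sum_congr rfl e3] at hcs
  have h3 : ∑ x ∈ S, μ x ≤ A := by
    have := hcount 1 le_rfl
    rwa [one_pow, mul_one] at this
  have h4 : ∑ x ∈ S, μ x * f x ^ 2 ≤ B₀ ^ 2 :=
    (sum_le_sum_of_subset_of_nonneg hSs fun x hx _ => mul_nonneg (hμ x hx) (sq_nonneg _)).trans hℓ2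
  calc ∑ x ∈ S, μ x * r x ^ a * f x ≤ Real.sqrt (∑ x ∈ S, μ x) * Real.sqrt (∑ x ∈ S, μ x * f x ^ 2) := h1.trans h2
    _ ≤ Real.sqrt A * Real.sqrt (B₀ ^ 2) := by gcongr
    _ = Real.sqrt A * B₀ := by rw [Real.sqrt_sq hB₀]

/-- **Bernstein's dyadic interpolation, full sum.**  `sum_mul_pow_mul_le_sqrt` over `{1 ≤ r}` plus the near region
`sum_mul_pow_mul_filter_lt_one_le` over `{r < 1}`:
`Σ_{x ∈ s} μ r^a f ≤ √A · (B₀ + 2 θ^{2a+d} θ^m/(θ^m - 1) · √(B₁ B₂))`, `θ = √2`. [cite: Katznelson2004, Ch. I §6.3, Theorem (Bernstein), pp. 57–58] -/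
theorem sum_mul_pow_mul_le_sqrt_add (s : Finset ι) (μ f r : ι → ℝ) (hμ : ∀ x ∈ s, 0 ≤ μ x) (hf : ∀ x ∈ s, 0 ≤ f x)
    (hr : ∀ x ∈ s, 0 ≤ r x) {a d j₁ j₂ m : ℕ} (hm₁ : 2 * j₁ + m = 2 * a + d) (hm₂ : 2 * a + d + m = 2 * j₂)
    (hm0 : 0 < m) {A B₀ B₁ B₂ : ℝ} (hA : 0 ≤ A) (hB₀ : 0 ≤ B₀) (hB₁ : 0 ≤ B₁) (hB₂ : 0 ≤ B₂)
    (hcount : ∀ R : ℝ, 1 ≤ R → ∑ x ∈ s.filter (fun x => r x < R), μ x ≤ A * R ^ d)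
    (hℓ2 : ∑ x ∈ s, μ x * f x ^ 2 ≤ B₀ ^ 2)
    (htail₁ : ∑ x ∈ s.filter (fun x => 1 ≤ r x), μ x * r x ^ (2 * j₁) * f x ^ 2 ≤ B₁ ^ 2)
    (htail₂ : ∑ x ∈ s.filter (fun x => 1 ≤ r x), μ x * r x ^ (2 * j₂) * f x ^ 2 ≤ B₂ ^ 2) :
    ∑ x ∈ s, μ x * r x ^ a * f x ≤
      Real.sqrt A * (B₀ + 2 * Real.sqrt 2 ^ (2 * a + d) * (Real.sqrt 2 ^ m / (Real.sqrt 2 ^ m - 1)) * Real.sqrt (B₁ * B₂)) := by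
  rw [← sum_filter_add_sum_filter_not s (fun x => 1 ≤ r x)]
  have hnot : s.filter (fun x => ¬ 1 ≤ r x) = s.filter (fun x => r x < 1) :=
    filter_congr fun x _ => not_le
  rw [hnot]
  have h1 := sum_mul_pow_mul_le_sqrt s μ f r hμ hf hr hm₁ hm₂ hm0 hA hB₁ hB₂ hcount htail₁ htail₂
  have h2 := sum_mul_pow_mul_filter_lt_one_le s μ f r hμ hf hr a hB₀ hcount hℓ2
  calc ∑ x ∈ s.filter (fun x => 1 ≤ r x), μ x * r x ^ a * f x + ∑ x ∈ s.filter (fun x => r x < 1), μ x * r x ^ a * f x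
      ≤ 2 * Real.sqrt 2 ^ (2 * a + d) * (Real.sqrt 2 ^ m / (Real.sqrt 2 ^ m - 1)) * Real.sqrt A * Real.sqrt (B₁ * B₂) +
          Real.sqrt A * B₀ := add_le_add h1 h2
    _ = Real.sqrt A * (B₀ + 2 * Real.sqrt 2 ^ (2 * a + d) * (Real.sqrt 2 ^ m / (Real.sqrt 2 ^ m - 1)) * Real.sqrt (B₁ * B₂)) := by
          ring

end Abstract

end Literature.Probability.LatticeModels

end
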